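/-
Copyright (c) 2026 the pub-hodgecm-mathlib formalisation cell (harness21).  Prover seat hodgecm-mathlib-LH4-p09 (g8), req620 Track A «(D-RAM) FOUR-FRAME» squad
(heir LEAD F0P3a-plan (g20) T19-24 «STAGE-1b PRE-SCOPING BY IDLE HANDS: ALLOWED AS SCOPING»; dealer LH4-plan (g12) WORD #49 «(L-model-G)»; heir dealer LH4-plan (g13)).  2026-09-04.
-/
import Summits.HodgeConjecture.HodgeConjecture.Theorems.F0P3cDyRamLabelledGluedClassCut    -- (this seat): token in `κ`-currency, generic class-cut orbit count; brings ★ B56 F1–F4, ★ (iv-c), ★ bridge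
import HarnessLib

/-!
# (D-RAM) four-frame, STAGE 1b scoping — unit (L-model-G) item (1), HEADS: the labelled glued stratum `G1 (2ρ, 2ρ+2t′, 2ρ+2t′)` ON THE CANCELLATION
# LOCUS `|e₂ − e₁| = |e₂ − e₀|·|ϖ|^{2t′}` — the honest sub-stratum census, trichotomy in `k = v(e₂ − e₀)`

STAGE-1b SCOPING BRICK in the sense of heir LEAD F0P3a-plan (g20) T19-24 and dealer LH4-plan (g12) WORD #49 (unit «(L-model-G)», item (1) «where the mixed
inequality CUTS the stratum, the honest sub-stratum census as the producer's TARGET»): `Theorems/` only, statement-first, ★-only imports, helper lane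
`--supports stmt-HodgeConjecture-24833 --as helper`; it PAYS NO tier-0 row and states no STAGE-1b law (count-neutral; rule 66: a census, not a law).

THE CENSUS.  Put `k = v(e₂ − e₀)` and work on the locus `v(e₂ − e₁) = k + 2t′` (`t′ ≥ 1`; off the locus ★ p859257 already gives the closed form).  On the glued
normal form the token reads `[|eᵢ| ≤ |ϖ|^ℓ] ∧ ℓ + ρ ≤ k ∧ |ϖ|^k·|κ + g_e| ≤ |ϖ|^{ℓ+2ρ+2t′}` (§1; `κ = y″∕(xζ)`, `g_e = (e₂−e₁)∕(e₂−e₀)`, `|g_e| = |ϖ|^{2t′}`), a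
class condition on ★ (iv-a)'s glue invariant; by the generic class-cut orbit count (this seat, `F0P3cDyRamLabelledGluedClassCut`) the label-cut weight is
`[outer] · #{g ∈ R : [stability ball ∧] token ball} · q^{ρ+⌊(ρ+2t′)∕2⌋}` for any representative system `R` of ★ (iv-c) (§2: TUBE and FOOT, plus the EMPTY
regimes), and ★ F3a `ncard_glue_representatives_eq` closes the tube count (§3): with `E = ℓ + 2ρ + 2t′ − k`,
`Σᶠ_{M ∈ G1, diag(e)M ⊆ ϖ^ℓM} w = [|eᵢ| ≤ |ϖ|^ℓ ∧ ℓ+ρ ≤ k] · { (q−1)q^{2ρ+t′−1} if ℓ+2ρ ≤ k (token ball vacuous: ★ B56's tube value);`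
`q^{2ρ+2t′−⌈E∕2⌉}·[∃ σ-fixed f₀ : |f₀ + g_e| ≤ |ϖ|^E] if ℓ+ρ ≤ k < ℓ+2ρ (the GENUINE CUT, 2t′ < E ≤ ρ+2t′) }`.
The residual indicator «`−g_e` is `F`-rational to depth `E`» is the honest datum of the cut; for the model token `D₁ = diag(α−1, β−1, 0)` one has `g_e = g₀ =
(β−1)∕(α−1)` and ★ `exists_fixed_v_add_glueUnit_le_iff` turns it into `E − 2t′ ≤ n₃ − d + 1` (next file, with the FOOT closed form by ball nesting).

* §1 `latticeInLevel_diagonal_latt_glued_iff_onLocus`, `v_glueRatio_eq`, `tokenBall_of_le`, `tokenBall_iff_of_add_eq`.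
* §2 **`finsum_stabiliserWeight_stratum_G1_sep_onLocus_tube_eq_ncard_mul`**, **`…_foot_eq_ncard_mul`** (R-currency), `…_sep_eq_zero_of_offFoot`,
  `…_sep_eq_zero_of_depth_lt`, `…_sep_eq_zero_of_odd` (empty regimes, any token).
* §3 **`finsum_stabiliserWeight_stratum_G1_sep_onLocus_tube`** — the TUBE census in closed form (trichotomy).

HONEST LABEL: scoping inventory; STAGE-1b tier-0 rows T₊∕T₋∕regular stay OPEN; HC_CM is proved only modulo the 7 printed citations (2 remaining named
inputs: hLiu418 = `stmt-HodgeConjecture-24832`, h413 = `stmt-HodgeConjecture-24833`) until rung 0 closes.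

## References
* [Kottwitz1986BaseChangeUnits] R. E. Kottwitz, *Base change for unit elements of Hecke algebras*, Compositio Math. 60 (1986), §1 pp. 240–241 (lattice counts via torus orbits and stabilisers).
* [Rogawski1990] J. D. Rogawski, *Automorphic Representations of Unitary Groups in Three Variables*, Ann. of Math. Stud. 123 (1990), §4.9 Prop. 4.9.1 (a) p. 55.
* [Serre1979] J.-P. Serre, *Local Fields*, GTM 67 (1979), Ch. IV §2 Prop. 6 (unit filtration counts behind ★ (iv-c) ∕ ★ F3a).
* [Serre1980Trees] J.-P. Serre, *Trees*, Springer (1980), Ch. II §1.1 (lattices, the ultrametric inequality).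
-/

set_option autoImplicit false

noncomputable section

namespace Summit.HodgeConjecture.HodgeConjecture.Cruxes.H413.F0P3cDyRamLabelledGluedLocusCensus

open Matrix WithZero
open Literature.NumberTheory.Automorphic Literature.NumberTheory.Automorphic.HermitianLattice
open Literature.NumberTheory.Automorphic.UnitaryLatticeTree Literature.NumberTheory.Automorphic.UnitaryThreeFourFrame
open Literature.NumberTheory.LocalFields.WildQuadraticDatum
open Summit.HodgeConjecture.HodgeConjecture.Cruxes.H413.F0P3cDyRamDiagonalTorusDefs
open Summit.HodgeConjecture.HodgeConjecture.Cruxes.H413.F0P3cDyRamDiagonalStrataDefs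
open Summit.HodgeConjecture.HodgeConjecture.Cruxes.H413.F0P3cDyRamDiagonalGluedTorusOrbits (exists_gl_coe_eq_glued)
open Summit.HodgeConjecture.HodgeConjecture.Cruxes.H413.F0P3cDyRamDiagonalGluedStabiliserIndex (ne_zero_and_v_lt_one_of_v_eq_exp)
open Summit.HodgeConjecture.HodgeConjecture.Cruxes.H413.F0P3cDyRamDiagonalGluedStabiliserMembership (pow_mul_le_pow_add_iff)
open Summit.HodgeConjecture.HodgeConjecture.Cruxes.H413.F0P3cDyRamDiagonalGluedStability (mapGL_latt_hnf_glued_eq_of_depths)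
open Summit.HodgeConjecture.HodgeConjecture.Cruxes.H413.F0P3cDyRamDiagonalGluedFootClasses
open Summit.HodgeConjecture.HodgeConjecture.Cruxes.H413.F0P3cDyRamDiagonalGluedClassRepresentatives (exists_fixed_class_representatives)
open Summit.HodgeConjecture.HodgeConjecture.Cruxes.H413.F0P3cDyRamDiagonalGluedStratum (stratum_G1_eq stratum_G1_eq_empty_of_odd)
open Summit.HodgeConjecture.HodgeConjecture.Cruxes.H413.F0P3cDyRamDiagonalGluedTubeContribution (glued_eq_empty_of_offFoot glued_eq_empty_of_depth_lt)
open Summit.HodgeConjecture.HodgeConjecture.Cruxes.H413.F0P3cDyRamFourFrameCensusDefs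
open Summit.HodgeConjecture.HodgeConjecture.Cruxes.H413.F0P3cDyRamLabelledGluedClassCut
open scoped Valued WithZero Matrix MatrixGroups

/-! ## §1  The token on the locus, in exponents -/

section Read

variable {K : Type*} [Field K] [Valued K ℤᵐ⁰]

/-- `|g_e| = |ϖ|^{2t′}` on the locus: `|(e₂ − e₁)∕(e₂ − e₀)| = |ϖ|^{k+2t′}∕|ϖ|^k`. [cite: Serre1980Trees, II §1.1] -/
theorem v_glueRatio_eq {ϖ : K} (hϖ0 : ϖ ≠ 0) {k t' : ℕ} {e : Fin 3 → K} (hk : Valued.v (e 2 - e 0) = Valued.v ϖ ^ k)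
    (hloc : Valued.v (e 2 - e 1) = Valued.v ϖ ^ (k + 2 * t')) : Valued.v ((e 2 - e 1) / (e 2 - e 0)) = Valued.v ϖ ^ (2 * t') := by
  have hvϖ0 : Valued.v ϖ ≠ 0 := (Valuation.ne_zero_iff _).2 hϖ0
  rw [map_div₀, hk, hloc, pow_add, mul_div_cancel_left₀ _ (pow_ne_zero k hvϖ0)]

/-- **THE TOKEN ON THE GLUED NORMAL FORM, ON THE LOCUS, IN EXPONENTS** (`v(e₂ − e₀) = k`, `v(e₂ − e₁) = k + 2t′`, `t′ ≥ 1`, `|x| = |ζ| = 1`):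
`diag(e)·latt V ⊆ ϖ^ℓ·latt V ⟺ ([|eᵢ| ≤ |ϖ|^ℓ] ∧ ℓ + ρ ≤ k) ∧ |ϖ|^k·|κ + g_e| ≤ |ϖ|^{ℓ+2ρ+2t′}` — the two outer difference conjuncts both read `ℓ + ρ ≤ k`
because `|e₁ − e₀| = |ϖ|^k` (ultrametric, `|e₂ − e₁| < |e₂ − e₀|`). [cite: Kottwitz1986BaseChangeUnits, §1 pp. 240–241] [cite: Serre1980Trees, II §1.1] -/
theorem latticeInLevel_diagonal_latt_glued_iff_onLocus {ϖ : K} (hϖ : Valued.v ϖ = exp (-1 : ℤ)) (ℓ ρ t' k : ℕ) (ht' : 1 ≤ t') (e : Fin 3 → K)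
    (hk : Valued.v (e 2 - e 0) = Valued.v ϖ ^ k) (hloc : Valued.v (e 2 - e 1) = Valued.v ϖ ^ (k + 2 * t')) {x ζ : K}
    (hx : Valued.v x = 1) (hζ : Valued.v ζ = 1) (y'' : K) :
    LatticeInLevel ϖ ℓ (Matrix.diagonal e) (latt (!![1, 0, 0; x, ϖ ^ ρ, 0; x * ζ + y'', ϖ ^ ρ * ζ, ϖ ^ (2 * ρ + 2 * t')] : Matrix (Fin 3) (Fin 3) K)) ↔
      ((Valued.v (e 0) ≤ Valued.v ϖ ^ ℓ ∧ Valued.v (e 1) ≤ Valued.v ϖ ^ ℓ ∧ Valued.v (e 2) ≤ Valued.v ϖ ^ ℓ) ∧ ℓ + ρ ≤ k) ∧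
        Valued.v ϖ ^ k * Valued.v (y'' / (x * ζ) + (e 2 - e 1) / (e 2 - e 0)) ≤ Valued.v ϖ ^ (ℓ + 2 * ρ + 2 * t') := by
  obtain ⟨hϖ0, hϖ1⟩ := ne_zero_and_v_lt_one_of_v_eq_exp hϖ
  have hvϖ0 : Valued.v ϖ ≠ 0 := (Valuation.ne_zero_iff _).2 hϖ0
  have he : e 2 ≠ e 0 := fun h => by
    rw [h, sub_self, map_zero] at hk
    exact pow_ne_zero k hvϖ0 hk.symm
  have hlt : Valued.v (e 2 - e 1) < Valued.v (e 2 - e 0) := by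
    rw [hk, hloc, pow_add]
    exact mul_lt_of_lt_one_right (pow_pos ((Valuation.pos_iff _).2 hϖ0) _) (pow_lt_one₀ zero_le hϖ1 (by omega))
  have h10 : Valued.v (e 1 - e 0) = Valued.v ϖ ^ k := by
    rw [show e 1 - e 0 = (e 2 - e 0) - (e 2 - e 1) by ring, Valuation.map_sub_eq_of_lt_left _ hlt, hk]
  have hp : ∀ m n : ℕ, Valued.v ϖ ^ m ≤ Valued.v ϖ ^ n ↔ n ≤ m := fun m n => UnitaryLatticeTree.v_pow_le_v_pow_iff hϖ m n
  rw [latticeInLevel_diagonal_latt_glued_iff_kappa hϖ0 ℓ ρ (2 * t') e he hx hζ y'', h10, hloc, hk, hp, hp,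
    show ℓ + ρ + 2 * t' ≤ k + 2 * t' ↔ ℓ + ρ ≤ k from ⟨fun h => by omega, fun h => by omega⟩]
  constructor
  · rintro ⟨h0, h1, -, h3⟩; exact ⟨⟨h0, h1⟩, h3⟩
  · rintro ⟨⟨h0, h1⟩, h3⟩; exact ⟨h0, h1, h1, h3⟩

/-- **VACUOUS REGIME** `ℓ + 2ρ ≤ k`: the token ball holds for every `g` of valuation `|ϖ|^{2t′}` (`|g + g_e| ≤ |ϖ|^{2t′}` and `|ϖ|^{k+2t′} ≤ |ϖ|^{ℓ+2ρ+2t′}`).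
[cite: Serre1980Trees, II §1.1] -/
theorem tokenBall_of_le {ϖ : K} (hϖ1 : Valued.v ϖ ≤ 1) {k ℓ ρ t' : ℕ} (hk : ℓ + 2 * ρ ≤ k) {g h : K} (hg : Valued.v g = Valued.v ϖ ^ (2 * t'))
    (hh : Valued.v h = Valued.v ϖ ^ (2 * t')) : Valued.v ϖ ^ k * Valued.v (g + h) ≤ Valued.v ϖ ^ (ℓ + 2 * ρ + 2 * t') := by
  refine (mul_le_mul' (pow_le_pow_right_of_le_one' hϖ1 hk) ((Valuation.map_add _ _ _).trans (max_le hg.le hh.le))).trans ?_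
  rw [← pow_add]

/-- **GENUINE REGIME**: with `ℓ + 2ρ + 2t′ = k + E` the token ball is `|g + g_e| ≤ |ϖ|^E` (★ `pow_mul_le_pow_add_iff`). [cite: Serre1980Trees, II §1.1] -/
theorem tokenBall_iff_of_add_eq {ϖ : K} (hϖ0 : ϖ ≠ 0) {k ℓ ρ t' E : ℕ} (hE : ℓ + 2 * ρ + 2 * t' = k + E) (g h : K) :
    Valued.v ϖ ^ k * Valued.v (g + h) ≤ Valued.v ϖ ^ (ℓ + 2 * ρ + 2 * t') ↔ Valued.v (g + h) ≤ Valued.v ϖ ^ E := by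
  rw [hE, pow_mul_le_pow_add_iff hϖ0]

end Read

/-! ## §2  The on-locus census in `R`-currency: tube, foot, and the empty regimes -/

section Census

variable {K : Type} [Field K] [Valued K ℤᵐ⁰] [Fintype 𝓀[K]] {σ : K →+* K} {ϖ : K} {d t : ℕ} {α β : K} {N₀ n₁ n₂ n₃ : ℕ} {T : GL (Fin 3) K}

/-- **HEAD (TUBE, `R`-CURRENCY) — THE LABELLED G1 WEIGHT ON THE LOCUS** (`2ρ + 2t′ ≤ n₁`, `2ρ ≤ n₂`; `v(e₂−e₀) = k`, `v(e₂−e₁) = k + 2t′`): for any irredundant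
complete system `R` of the `σ`-fixed elements of valuation `|ϖ|^{2t′}` modulo `𝔭^{ρ+2t′}` (★ (iv-c)),
`Σᶠ_{M ∈ G1, diag(e)M ⊆ ϖ^ℓM} 1∕[𝒰 : S_F(M)] = [|eᵢ| ≤ |ϖ|^ℓ ∧ ℓ+ρ ≤ k] · #{g ∈ R : |ϖ|^k·|g + g_e| ≤ |ϖ|^{ℓ+2ρ+2t′}} · q^{ρ+⌊(ρ+2t′)∕2⌋}`
(★ F1 `stratum_G1_eq`, ★ B5 (ii) stability on the tube, §1 read, generic class-cut orbit count). [cite: Kottwitz1986BaseChangeUnits, §1 pp. 240–241]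
[cite: Rogawski1990, §4.9 Prop. 4.9.1 (a) p. 55] -/
theorem finsum_stabiliserWeight_stratum_G1_sep_onLocus_tube_eq_ncard_mul (hD : IsRamifiedQuadraticDatum σ ϖ d t) (h2 : Valued.v (2 : K) < 1)
    (hE : IsElementDatum σ ϖ N₀ α β n₁ n₂ n₃) (hT : (T : Matrix (Fin 3) (Fin 3) K) = Matrix.diagonal ![α, β, 1])
    (ρ t' : ℕ) (hρ : 1 ≤ ρ) (ht' : 1 ≤ t') (htube : 2 * ρ + 2 * t' ≤ n₁ ∧ 2 * ρ ≤ n₂) (ℓ k : ℕ) (e : Fin 3 → K)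
    (hk : Valued.v (e 2 - e 0) = Valued.v ϖ ^ k) (hloc : Valued.v (e 2 - e 1) = Valued.v ϖ ^ (k + 2 * t')) {R : Set K} (hRfin : R.Finite)
    (hR1 : ∀ g ∈ R, σ g = g ∧ Valued.v g = Valued.v ϖ ^ (2 * t'))
    (hR2 : ∀ f : K, σ f = f → Valued.v f = Valued.v ϖ ^ (2 * t') → ∃ g ∈ R, Valued.v (f - g) ≤ Valued.v ϖ ^ (ρ + 2 * t'))
    (hR3 : ∀ g ∈ R, ∀ g' ∈ R, Valued.v (g - g') ≤ Valued.v ϖ ^ (ρ + 2 * t') → g = g') :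
    ∑ᶠ M ∈ {M | M ∈ stratum σ ϖ T ![2 * ρ, 2 * ρ + 2 * t', 2 * ρ + 2 * t'] ∧ LatticeInLevel ϖ ℓ (Matrix.diagonal e) M}, stabiliserWeight σ M =
      if (Valued.v (e 0) ≤ Valued.v ϖ ^ ℓ ∧ Valued.v (e 1) ≤ Valued.v ϖ ^ ℓ ∧ Valued.v (e 2) ≤ Valued.v ϖ ^ ℓ) ∧ ℓ + ρ ≤ k then
        ({g ∈ R | Valued.v ϖ ^ k * Valued.v (g + (e 2 - e 1) / (e 2 - e 0)) ≤ Valued.v ϖ ^ (ℓ + 2 * ρ + 2 * t')}.ncard : ℚ) *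
          (Fintype.card 𝓀[K] : ℚ) ^ (ρ + (ρ + 2 * t') / 2)
      else 0 := by
  classical
  have hTr := trace_bound_of_isRamifiedQuadraticDatum hD h2
  obtain ⟨hσ, hvσ, hϖ, hfix, hd, -, -⟩ := hD
  obtain ⟨hαn, hβn, -, -, -, h₁, h₂, h₃, -, -, -⟩ := hE
  have hα := UnitaryThreeFourFrame.v_eq_one_of_mul_map_eq_one hvσ hαn
  have hβ := UnitaryThreeFourFrame.v_eq_one_of_mul_map_eq_one hvσ hβn
  have h₃' : Valued.v (β - α) = Valued.v ϖ ^ n₃ := by rw [Valuation.map_sub_swap, h₃]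
  obtain ⟨hϖ0, hϖ1⟩ := ne_zero_and_v_lt_one_of_v_eq_exp hϖ
  obtain ⟨hi1, -, -⟩ := isoceles_depths hϖ h₁ h₂ h₃
  have hn₃ : ρ ≤ n₃ := by
    rcases min_le_iff.1 hi1 with h | h <;> omega
  have hpρ : ϖ ^ ρ ≠ 0 := pow_ne_zero ρ hϖ0
  have hpr : ϖ ^ (2 * ρ + 2 * t') ≠ 0 := pow_ne_zero _ hϖ0
  have hs : 1 ≤ 2 * t' := by omega
  have hread : ∀ {x ζ : K}, Valued.v x = 1 → Valued.v ζ = 1 → ∀ y'' : K,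
      LatticeInLevel ϖ ℓ (Matrix.diagonal e) (latt (!![1, 0, 0; x, ϖ ^ ρ, 0; x * ζ + y'', ϖ ^ ρ * ζ, ϖ ^ (2 * ρ + 2 * t')] : Matrix (Fin 3) (Fin 3) K)) ↔
        ((Valued.v (e 0) ≤ Valued.v ϖ ^ ℓ ∧ Valued.v (e 1) ≤ Valued.v ϖ ^ ℓ ∧ Valued.v (e 2) ≤ Valued.v ϖ ^ ℓ) ∧ ℓ + ρ ≤ k) ∧
          Valued.v ϖ ^ k * Valued.v (y'' / (x * ζ) + (e 2 - e 1) / (e 2 - e 0)) ≤ Valued.v ϖ ^ (ℓ + 2 * ρ + 2 * t') :=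
    fun hx hζ y'' => latticeInLevel_diagonal_latt_glued_iff_onLocus hϖ ℓ ρ t' k ht' e hk hloc hx hζ y''
  rw [← Nat.card_eq_fintype_card]
  by_cases hout : (Valued.v (e 0) ≤ Valued.v ϖ ^ ℓ ∧ Valued.v (e 1) ≤ Valued.v ϖ ^ ℓ ∧ Valued.v (e 2) ≤ Valued.v ϖ ^ ℓ) ∧ ℓ + ρ ≤ k
  · rw [if_pos hout]
    have hset : {M | M ∈ stratum σ ϖ T ![2 * ρ, 2 * ρ + 2 * t', 2 * ρ + 2 * t'] ∧ LatticeInLevel ϖ ℓ (Matrix.diagonal e) M} =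
        {M : Submodule 𝒪[K] (Fin 3 → K) | ∃ x ζ y'' : K, Valued.v x = 1 ∧ Valued.v ζ = 1 ∧ Valued.v y'' = Valued.v ϖ ^ (2 * t') ∧
          M = latt (!![1, 0, 0; x, ϖ ^ ρ, 0; x * ζ + y'', ϖ ^ ρ * ζ, ϖ ^ (2 * ρ + 2 * t')] : Matrix (Fin 3) (Fin 3) K) ∧ IsDualisableLattice σ ϖ M ∧
          Valued.v ϖ ^ k * Valued.v (y'' / (x * ζ) + (e 2 - e 1) / (e 2 - e 0)) ≤ Valued.v ϖ ^ (ℓ + 2 * ρ + 2 * t')} := by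
      ext M
      simp only [Set.mem_setOf_eq]
      constructor
      · rintro ⟨hM, hL⟩
        rw [stratum_G1_eq hvσ hfix hϖ T hρ hs] at hM
        obtain ⟨x, ζ, y'', hx, hζ, hy, rfl, -, hdu⟩ := hM
        exact ⟨x, ζ, y'', hx, hζ, hy, rfl, hdu, ((hread hx hζ y'').1 hL).2⟩
      · rintro ⟨x, ζ, y'', hx, hζ, hy, rfl, hdu, hP⟩
        refine ⟨?_, (hread hx hζ y'').2 ⟨hout, hP⟩⟩
        rw [stratum_G1_eq hvσ hfix hϖ T hρ hs]
        obtain ⟨V, hV⟩ := exists_gl_coe_eq_glued x ζ y'' hpρ hpr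
        refine ⟨x, ζ, y'', hx, hζ, hy, rfl, ?_, hdu⟩
        rw [← hV]
        exact mapGL_latt_hnf_glued_eq_of_depths hϖ0 hϖ1.le hα hβ T hT h₁ h₂ h₃' ρ (2 * t') htube.1 htube.2 hn₃ hx hζ hy V hV
    rw [hset, finsum_stabiliserWeight_glued_dualisable_sep_eq_ncard_mul hσ hvσ hfix hϖ hd hTr ρ t' hρ ht' hRfin hR1 hR2 hR3
        (fun κ => Valued.v ϖ ^ k * Valued.v (κ + (e 2 - e 1) / (e 2 - e 0)) ≤ Valued.v ϖ ^ (ℓ + 2 * ρ + 2 * t'))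
        (fun κ g _ hκg hκ => tokenBall_class (pow_le_pow_right_of_le_one' hϖ1.le hout.2) (by rw [Valuation.map_sub_swap]; exact hκg) hκ),
      mul_assoc, orbit_mul_weight_eq Finite.one_lt_card hρ t']
  · rw [if_neg hout]
    have hset : {M | M ∈ stratum σ ϖ T ![2 * ρ, 2 * ρ + 2 * t', 2 * ρ + 2 * t'] ∧ LatticeInLevel ϖ ℓ (Matrix.diagonal e) M} = ∅ :=
      Set.eq_empty_of_forall_notMem fun M ⟨hM, hL⟩ => by
        rw [stratum_G1_eq hvσ hfix hϖ T hρ hs] at hM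
        obtain ⟨x, ζ, y'', hx, hζ, -, rfl, -, -⟩ := hM
        exact hout ((hread hx hζ y'').1 hL).1
    rw [hset, finsum_mem_empty]

/-- **HEAD (FOOT, `R`-CURRENCY) — THE LABELLED G1 WEIGHT ON THE LOCUS** (glue foot `n₁ = n₂ + 2t′`, `ρ ≤ n₂ < 2ρ`; `v(e₂−e₀) = k`, `v(e₂−e₁) = k + 2t′`): the
label-cut weight is `[|eᵢ| ≤ |ϖ|^ℓ ∧ ℓ+ρ ≤ k] · #{g ∈ R : |g + (β−1)∕(α−1)| ≤ |ϖ|^{2ρ+2t′−n₂} ∧ |ϖ|^k·|g + g_e| ≤ |ϖ|^{ℓ+2ρ+2t′}} · q^{ρ+⌊(ρ+2t′)∕2⌋}` — TWO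
balls on the glue invariant: ★ F3a's stability ball and the token ball (nested or disjoint; closed form next file). [cite: Kottwitz1986BaseChangeUnits, §1 pp. 240–241]
[cite: Rogawski1990, §4.9 Prop. 4.9.1 (a) p. 55] -/
theorem finsum_stabiliserWeight_stratum_G1_sep_onLocus_foot_eq_ncard_mul (hD : IsRamifiedQuadraticDatum σ ϖ d t) (h2 : Valued.v (2 : K) < 1)
    (hE : IsElementDatum σ ϖ N₀ α β n₁ n₂ n₃) (hT : (T : Matrix (Fin 3) (Fin 3) K) = Matrix.diagonal ![α, β, 1])
    (ρ t' : ℕ) (hρ : 1 ≤ ρ) (ht' : 1 ≤ t') (hfoot : n₁ = n₂ + 2 * t') (hρm : ρ ≤ n₂) (hm : n₂ < 2 * ρ) (ℓ k : ℕ) (e : Fin 3 → K)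
    (hk : Valued.v (e 2 - e 0) = Valued.v ϖ ^ k) (hloc : Valued.v (e 2 - e 1) = Valued.v ϖ ^ (k + 2 * t')) {R : Set K} (hRfin : R.Finite)
    (hR1 : ∀ g ∈ R, σ g = g ∧ Valued.v g = Valued.v ϖ ^ (2 * t'))
    (hR2 : ∀ f : K, σ f = f → Valued.v f = Valued.v ϖ ^ (2 * t') → ∃ g ∈ R, Valued.v (f - g) ≤ Valued.v ϖ ^ (ρ + 2 * t'))
    (hR3 : ∀ g ∈ R, ∀ g' ∈ R, Valued.v (g - g') ≤ Valued.v ϖ ^ (ρ + 2 * t') → g = g') :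
    ∑ᶠ M ∈ {M | M ∈ stratum σ ϖ T ![2 * ρ, 2 * ρ + 2 * t', 2 * ρ + 2 * t'] ∧ LatticeInLevel ϖ ℓ (Matrix.diagonal e) M}, stabiliserWeight σ M =
      if (Valued.v (e 0) ≤ Valued.v ϖ ^ ℓ ∧ Valued.v (e 1) ≤ Valued.v ϖ ^ ℓ ∧ Valued.v (e 2) ≤ Valued.v ϖ ^ ℓ) ∧ ℓ + ρ ≤ k then
        ({g ∈ R | Valued.v (g + (β - 1) / (α - 1)) ≤ Valued.v ϖ ^ (2 * ρ + 2 * t' - n₂) ∧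
            Valued.v ϖ ^ k * Valued.v (g + (e 2 - e 1) / (e 2 - e 0)) ≤ Valued.v ϖ ^ (ℓ + 2 * ρ + 2 * t')}.ncard : ℚ) *
          (Fintype.card 𝓀[K] : ℚ) ^ (ρ + (ρ + 2 * t') / 2)
      else 0 := by
  classical
  have hTr := trace_bound_of_isRamifiedQuadraticDatum hD h2
  obtain ⟨hσ, hvσ, hϖ, hfix, hd, -, -⟩ := hD
  obtain ⟨hαn, hβn, -, -, -, h₁, h₂, h₃, -, -, -⟩ := hE
  have hα := UnitaryThreeFourFrame.v_eq_one_of_mul_map_eq_one hvσ hαn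
  have hβ := UnitaryThreeFourFrame.v_eq_one_of_mul_map_eq_one hvσ hβn
  obtain ⟨hϖ0, hϖ1⟩ := ne_zero_and_v_lt_one_of_v_eq_exp hϖ
  obtain ⟨hi1, hi2, -⟩ := isoceles_depths hϖ h₁ h₂ h₃
  have hn₃ : n₃ = n₂ := by
    rcases min_le_iff.1 hi1 with h | h <;> rcases min_le_iff.1 hi2 with h' | h' <;> omega
  subst hn₃
  rw [hfoot] at h₁
  have h₃' : Valued.v (β - α) = Valued.v ϖ ^ n₃ := by rw [Valuation.map_sub_swap, h₃]
  have hm' : n₃ ≤ 2 * ρ + 2 * t' := by omega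
  have hpρ : ϖ ^ ρ ≠ 0 := pow_ne_zero ρ hϖ0
  have hpr : ϖ ^ (2 * ρ + 2 * t') ≠ 0 := pow_ne_zero _ hϖ0
  have hs : 1 ≤ 2 * t' := by omega
  have hen : Valued.v ϖ ^ (ρ + 2 * t') ≤ Valued.v ϖ ^ (2 * ρ + 2 * t' - n₃) := pow_le_pow_right_of_le_one' hϖ1.le (by omega)
  have hread : ∀ {x ζ : K}, Valued.v x = 1 → Valued.v ζ = 1 → ∀ y'' : K,
      LatticeInLevel ϖ ℓ (Matrix.diagonal e) (latt (!![1, 0, 0; x, ϖ ^ ρ, 0; x * ζ + y'', ϖ ^ ρ * ζ, ϖ ^ (2 * ρ + 2 * t')] : Matrix (Fin 3) (Fin 3) K)) ↔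
        ((Valued.v (e 0) ≤ Valued.v ϖ ^ ℓ ∧ Valued.v (e 1) ≤ Valued.v ϖ ^ ℓ ∧ Valued.v (e 2) ≤ Valued.v ϖ ^ ℓ) ∧ ℓ + ρ ≤ k) ∧
          Valued.v ϖ ^ k * Valued.v (y'' / (x * ζ) + (e 2 - e 1) / (e 2 - e 0)) ≤ Valued.v ϖ ^ (ℓ + 2 * ρ + 2 * t') :=
    fun hx hζ y'' => latticeInLevel_diagonal_latt_glued_iff_onLocus hϖ ℓ ρ t' k ht' e hk hloc hx hζ y''
  have hstab : ∀ {x ζ y'' : K}, Valued.v x = 1 → Valued.v ζ = 1 →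
      (mapGL T (latt (!![1, 0, 0; x, ϖ ^ ρ, 0; x * ζ + y'', ϖ ^ ρ * ζ, ϖ ^ (2 * ρ + 2 * t')] : Matrix (Fin 3) (Fin 3) K)) =
          latt (!![1, 0, 0; x, ϖ ^ ρ, 0; x * ζ + y'', ϖ ^ ρ * ζ, ϖ ^ (2 * ρ + 2 * t')] : Matrix (Fin 3) (Fin 3) K) ↔
        Valued.v (y'' / (x * ζ) + (β - 1) / (α - 1)) ≤ Valued.v ϖ ^ (2 * ρ + 2 * t' - n₃)) := by
    intro x ζ y'' hx hζ
    obtain ⟨V, hV⟩ := exists_gl_coe_eq_glued x ζ y'' hpρ hpr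
    rw [← hV]
    exact mapGL_latt_glued_eq_iff_kappa hϖ hα hβ T hT h₁ h₂ h₃' hρm hm' hx hζ V hV
  rw [← Nat.card_eq_fintype_card]
  by_cases hout : (Valued.v (e 0) ≤ Valued.v ϖ ^ ℓ ∧ Valued.v (e 1) ≤ Valued.v ϖ ^ ℓ ∧ Valued.v (e 2) ≤ Valued.v ϖ ^ ℓ) ∧ ℓ + ρ ≤ k
  · rw [if_pos hout]
    have hset : {M | M ∈ stratum σ ϖ T ![2 * ρ, 2 * ρ + 2 * t', 2 * ρ + 2 * t'] ∧ LatticeInLevel ϖ ℓ (Matrix.diagonal e) M} =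
        {M : Submodule 𝒪[K] (Fin 3 → K) | ∃ x ζ y'' : K, Valued.v x = 1 ∧ Valued.v ζ = 1 ∧ Valued.v y'' = Valued.v ϖ ^ (2 * t') ∧
          M = latt (!![1, 0, 0; x, ϖ ^ ρ, 0; x * ζ + y'', ϖ ^ ρ * ζ, ϖ ^ (2 * ρ + 2 * t')] : Matrix (Fin 3) (Fin 3) K) ∧ IsDualisableLattice σ ϖ M ∧
          (Valued.v (y'' / (x * ζ) + (β - 1) / (α - 1)) ≤ Valued.v ϖ ^ (2 * ρ + 2 * t' - n₃) ∧
            Valued.v ϖ ^ k * Valued.v (y'' / (x * ζ) + (e 2 - e 1) / (e 2 - e 0)) ≤ Valued.v ϖ ^ (ℓ + 2 * ρ + 2 * t'))} := by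
      ext M
      simp only [Set.mem_setOf_eq]
      constructor
      · rintro ⟨hM, hL⟩
        rw [stratum_G1_eq hvσ hfix hϖ T hρ hs] at hM
        obtain ⟨x, ζ, y'', hx, hζ, hy, rfl, hst, hdu⟩ := hM
        exact ⟨x, ζ, y'', hx, hζ, hy, rfl, hdu, (hstab hx hζ).1 hst, ((hread hx hζ y'').1 hL).2⟩
      · rintro ⟨x, ζ, y'', hx, hζ, hy, rfl, hdu, hball, hP⟩
        refine ⟨?_, (hread hx hζ y'').2 ⟨hout, hP⟩⟩
        rw [stratum_G1_eq hvσ hfix hϖ T hρ hs]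
        exact ⟨x, ζ, y'', hx, hζ, hy, rfl, (hstab hx hζ).2 hball, hdu⟩
    rw [hset, finsum_stabiliserWeight_glued_dualisable_sep_eq_ncard_mul hσ hvσ hfix hϖ hd hTr ρ t' hρ ht' hRfin hR1 hR2 hR3
        (fun κ => Valued.v (κ + (β - 1) / (α - 1)) ≤ Valued.v ϖ ^ (2 * ρ + 2 * t' - n₃) ∧
          Valued.v ϖ ^ k * Valued.v (κ + (e 2 - e 1) / (e 2 - e 0)) ≤ Valued.v ϖ ^ (ℓ + 2 * ρ + 2 * t'))
        (fun κ g _ hκg hκ => ⟨?_, tokenBall_class (pow_le_pow_right_of_le_one' hϖ1.le hout.2) (by rw [Valuation.map_sub_swap]; exact hκg) hκ.2⟩),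
      mul_assoc, orbit_mul_weight_eq Finite.one_lt_card hρ t']
    rw [show g + (β - 1) / (α - 1) = (κ + (β - 1) / (α - 1)) - (κ - g) by ring]
    exact Valuation.map_sub_le _ hκ.1 (hκg.trans hen)
  · rw [if_neg hout]
    have hset : {M | M ∈ stratum σ ϖ T ![2 * ρ, 2 * ρ + 2 * t', 2 * ρ + 2 * t'] ∧ LatticeInLevel ϖ ℓ (Matrix.diagonal e) M} = ∅ :=
      Set.eq_empty_of_forall_notMem fun M ⟨hM, hL⟩ => by
        rw [stratum_G1_eq hvσ hfix hϖ T hρ hs] at hM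
        obtain ⟨x, ζ, y'', hx, hζ, -, rfl, -, -⟩ := hM
        exact hout ((hread hx hζ y'').1 hL).1
    rw [hset, finsum_mem_empty]

omit [Fintype 𝓀[K]] in
/-- **EMPTY BELOW THE TUBE AND OFF THE FOOT**: if `¬(2ρ + 2t′ ≤ n₁ ∧ 2ρ ≤ n₂)` and `n₁ ≠ n₂ + 2t′` the G1 stratum is empty (★ F2 `glued_eq_empty_of_offFoot`),
so every label-cut weight vanishes. [cite: Kottwitz1986BaseChangeUnits, §1 pp. 240–241] -/
theorem finsum_stabiliserWeight_stratum_G1_sep_eq_zero_of_offFoot (hD : IsRamifiedQuadraticDatum σ ϖ d t) (hE : IsElementDatum σ ϖ N₀ α β n₁ n₂ n₃)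
    (hT : (T : Matrix (Fin 3) (Fin 3) K) = Matrix.diagonal ![α, β, 1]) (ρ t' : ℕ) (hρ : 1 ≤ ρ) (ht' : 1 ≤ t')
    (hne : n₁ ≠ n₂ + 2 * t') (hlow : ¬ (2 * ρ + 2 * t' ≤ n₁ ∧ 2 * ρ ≤ n₂)) (L : Submodule 𝒪[K] (Fin 3 → K) → Prop) :
    ∑ᶠ M ∈ {M | M ∈ stratum σ ϖ T ![2 * ρ, 2 * ρ + 2 * t', 2 * ρ + 2 * t'] ∧ L M}, stabiliserWeight σ M = 0 := by
  obtain ⟨-, hvσ, hϖ, hfix, -, -, -⟩ := hD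
  obtain ⟨hαn, hβn, -, -, -, h₁, h₂, -, -, -, -⟩ := hE
  obtain ⟨hϖ0, hϖ1⟩ := ne_zero_and_v_lt_one_of_v_eq_exp hϖ
  have hset : {M | M ∈ stratum σ ϖ T ![2 * ρ, 2 * ρ + 2 * t', 2 * ρ + 2 * t'] ∧ L M} = ∅ :=
    Set.eq_empty_of_forall_notMem fun M ⟨hM, _⟩ => by
      rw [stratum_G1_eq hvσ hfix hϖ T hρ (by omega : 1 ≤ 2 * t'), glued_eq_empty_of_offFoot σ hϖ0 hϖ1
        (UnitaryThreeFourFrame.v_eq_one_of_mul_map_eq_one hvσ hαn) (UnitaryThreeFourFrame.v_eq_one_of_mul_map_eq_one hvσ hβn)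
        T hT h₁ h₂ ρ (2 * t') hne hlow] at hM
      exact hM
  rw [hset, finsum_mem_empty]

omit [Fintype 𝓀[K]] in
/-- **EMPTY WHEN TOO SHALLOW**: if `n₃ < ρ` the G1 stratum is empty (★ F2 `glued_eq_empty_of_depth_lt`), so every label-cut weight vanishes.
[cite: Kottwitz1986BaseChangeUnits, §1 pp. 240–241] -/
theorem finsum_stabiliserWeight_stratum_G1_sep_eq_zero_of_depth_lt (hD : IsRamifiedQuadraticDatum σ ϖ d t) (hE : IsElementDatum σ ϖ N₀ α β n₁ n₂ n₃)
    (hT : (T : Matrix (Fin 3) (Fin 3) K) = Matrix.diagonal ![α, β, 1]) (ρ s : ℕ) (hρ : 1 ≤ ρ) (hs : 1 ≤ s) (hlt : n₃ < ρ)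
    (L : Submodule 𝒪[K] (Fin 3 → K) → Prop) :
    ∑ᶠ M ∈ {M | M ∈ stratum σ ϖ T ![2 * ρ, 2 * ρ + s, 2 * ρ + s] ∧ L M}, stabiliserWeight σ M = 0 := by
  obtain ⟨-, hvσ, hϖ, hfix, -, -, -⟩ := hD
  obtain ⟨hαn, hβn, -, -, -, -, -, h₃, -, -, -⟩ := hE
  have h₃' : Valued.v (β - α) = Valued.v ϖ ^ n₃ := by rw [Valuation.map_sub_swap, h₃]
  have hset : {M | M ∈ stratum σ ϖ T ![2 * ρ, 2 * ρ + s, 2 * ρ + s] ∧ L M} = ∅ :=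
    Set.eq_empty_of_forall_notMem fun M ⟨hM, _⟩ => by
      rw [stratum_G1_eq hvσ hfix hϖ T hρ hs, glued_eq_empty_of_depth_lt σ hϖ
        (UnitaryThreeFourFrame.v_eq_one_of_mul_map_eq_one hvσ hαn) (UnitaryThreeFourFrame.v_eq_one_of_mul_map_eq_one hvσ hβn)
        T hT h₃' ρ s hlt] at hM
      exact hM
  rw [hset, finsum_mem_empty]

omit [Fintype 𝓀[K]] in
/-- **EMPTY FOR ODD GLUE EXPONENT**: the G1 stratum `(2ρ, 2ρ+s, 2ρ+s)` with `s` odd is empty (★ F1 `stratum_G1_eq_empty_of_odd`), so every label-cut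
weight vanishes. [cite: Kottwitz1986BaseChangeUnits, §1 pp. 240–241] -/
theorem finsum_stabiliserWeight_stratum_G1_sep_eq_zero_of_odd (hD : IsRamifiedQuadraticDatum σ ϖ d t) (T : GL (Fin 3) K) (ρ s : ℕ) (hρ : 1 ≤ ρ)
    (hodd : ¬ 2 ∣ s) (L : Submodule 𝒪[K] (Fin 3 → K) → Prop) :
    ∑ᶠ M ∈ {M | M ∈ stratum σ ϖ T ![2 * ρ, 2 * ρ + s, 2 * ρ + s] ∧ L M}, stabiliserWeight σ M = 0 := by
  obtain ⟨-, hvσ, hϖ, hfix, -, -, -⟩ := hD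
  have hset : {M | M ∈ stratum σ ϖ T ![2 * ρ, 2 * ρ + s, 2 * ρ + s] ∧ L M} = ∅ :=
    Set.eq_empty_of_forall_notMem fun M ⟨hM, _⟩ => by
      rw [stratum_G1_eq_empty_of_odd hvσ hfix hϖ T hρ hodd] at hM
      exact hM
  rw [hset, finsum_mem_empty]

end Census

/-! ## §3  The tube census in closed form -/

section Closed

variable {K : Type} [Field K] [Valued K ℤᵐ⁰] [Fintype 𝓀[K]] {σ : K →+* K} {ϖ : K} {d t : ℕ} {α β : K} {N₀ n₁ n₂ n₃ : ℕ} {T : GL (Fin 3) K}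

open Classical in
/-- **HEAD — THE LABELLED G1 WEIGHT ON THE LOCUS, TUBE REGIME, CLOSED FORM** (`2ρ + 2t′ ≤ n₁`, `2ρ ≤ n₂`; `v(e₂−e₀) = k`, `v(e₂−e₁) = k + 2t′`, `t′ ≥ 1`;
`E = ℓ + 2ρ + 2t′ − k`): `Σᶠ_{M ∈ G1, diag(e)M ⊆ ϖ^ℓM} 1∕[𝒰 : S_F(M)] =`
`[|eᵢ| ≤ |ϖ|^ℓ ∧ ℓ+ρ ≤ k] · ( (q−1)q^{2ρ+t′−1} if ℓ+2ρ ≤ k ;  q^{2ρ+2t′−⌈E∕2⌉}·[∃ f₀ = σf₀ : |f₀ + g_e| ≤ |ϖ|^E] otherwise )` — the vacuous regime returns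
★ B56's tube value, the genuine cut counts the `F`-rational classes in the token ball by ★ F3a `ncard_glue_representatives_eq` ∕ `glue_representatives_eq_empty`
over ★ (iv-c)'s representatives. [cite: Kottwitz1986BaseChangeUnits, §1 pp. 240–241] [cite: Serre1979, Ch. IV §2 Prop. 6] [cite: Rogawski1990, §4.9 Prop. 4.9.1 (a) p. 55] -/
theorem finsum_stabiliserWeight_stratum_G1_sep_onLocus_tube (hD : IsRamifiedQuadraticDatum σ ϖ d t) (h2 : Valued.v (2 : K) < 1)
    (hE : IsElementDatum σ ϖ N₀ α β n₁ n₂ n₃) (hT : (T : Matrix (Fin 3) (Fin 3) K) = Matrix.diagonal ![α, β, 1])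
    (ρ t' : ℕ) (hρ : 1 ≤ ρ) (ht' : 1 ≤ t') (htube : 2 * ρ + 2 * t' ≤ n₁ ∧ 2 * ρ ≤ n₂) (ℓ k : ℕ) (e : Fin 3 → K)
    (hk : Valued.v (e 2 - e 0) = Valued.v ϖ ^ k) (hloc : Valued.v (e 2 - e 1) = Valued.v ϖ ^ (k + 2 * t')) :
    ∑ᶠ M ∈ {M | M ∈ stratum σ ϖ T ![2 * ρ, 2 * ρ + 2 * t', 2 * ρ + 2 * t'] ∧ LatticeInLevel ϖ ℓ (Matrix.diagonal e) M}, stabiliserWeight σ M =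
      if (Valued.v (e 0) ≤ Valued.v ϖ ^ ℓ ∧ Valued.v (e 1) ≤ Valued.v ϖ ^ ℓ ∧ Valued.v (e 2) ≤ Valued.v ϖ ^ ℓ) ∧ ℓ + ρ ≤ k then
        (if ℓ + 2 * ρ ≤ k then ((Fintype.card 𝓀[K] : ℚ) - 1) * (Fintype.card 𝓀[K] : ℚ) ^ (2 * ρ + t' - 1)
          else if ∃ f : K, σ f = f ∧ Valued.v (f + (e 2 - e 1) / (e 2 - e 0)) ≤ Valued.v ϖ ^ (ℓ + 2 * ρ + 2 * t' - k)
            then (Fintype.card 𝓀[K] : ℚ) ^ (2 * ρ + 2 * t' - (ℓ + 2 * ρ + 2 * t' - k + 1) / 2) else 0)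
      else 0 := by
  classical
  have hσ : ∀ x, σ (σ x) = x := hD.1
  have hvσ : ∀ a, Valued.v (σ a) = Valued.v a := hD.2.1
  have hϖ : Valued.v ϖ = exp (-1 : ℤ) := hD.2.2.1
  have hfix : ∀ x : K, σ x = x → x ≠ 0 → ∃ n : ℤ, Valued.v x = exp (2 * n) := hD.2.2.2.1
  have hd : Valued.v (ϖ - σ ϖ) = Valued.v ϖ ^ d := hD.2.2.2.2.1
  obtain ⟨hϖ0, hϖ1⟩ := ne_zero_and_v_lt_one_of_v_eq_exp hϖ
  obtain ⟨R, hRfin, hRcard, hR1, hR2, hR3⟩ := exists_fixed_class_representatives hσ hvσ hfix hϖ hd ρ t' hρ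
  rw [finsum_stabiliserWeight_stratum_G1_sep_onLocus_tube_eq_ncard_mul hD h2 hE hT ρ t' hρ ht' htube ℓ k e hk hloc hRfin hR1 hR2 hR3]
  by_cases hout : (Valued.v (e 0) ≤ Valued.v ϖ ^ ℓ ∧ Valued.v (e 1) ≤ Valued.v ϖ ^ ℓ ∧ Valued.v (e 2) ≤ Valued.v ϖ ^ ℓ) ∧ ℓ + ρ ≤ k
  · rw [if_pos hout, if_pos hout, ← Nat.card_eq_fintype_card]
    have hq : 1 < Nat.card 𝓀[K] := Finite.one_lt_card
    have hge : Valued.v ((e 2 - e 1) / (e 2 - e 0)) = Valued.v ϖ ^ (2 * t') := v_glueRatio_eq hϖ0 hk hloc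
    by_cases hvac : ℓ + 2 * ρ ≤ k
    · -- vacuous regime: the token ball is all of `R`
      have hall : {g ∈ R | Valued.v ϖ ^ k * Valued.v (g + (e 2 - e 1) / (e 2 - e 0)) ≤ Valued.v ϖ ^ (ℓ + 2 * ρ + 2 * t')} = R :=
        Set.ext fun g => ⟨fun h => h.1, fun h => ⟨h, tokenBall_of_le hϖ1.le hvac (hR1 g h).2 hge⟩⟩
      rw [if_pos hvac, hall, hRcard, show 2 * ρ + t' - 1 = (ρ + 1) / 2 - 1 + (ρ + (ρ + 2 * t') / 2) by omega, pow_add]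
      push_cast [Nat.cast_sub hq.le]
      ring
    · -- genuine regime: `2t′ < E ≤ ρ + 2t′`
      rw [if_neg hvac]
      have hEeq : ℓ + 2 * ρ + 2 * t' = k + (ℓ + 2 * ρ + 2 * t' - k) := by omega
      have hball : {g ∈ R | Valued.v ϖ ^ k * Valued.v (g + (e 2 - e 1) / (e 2 - e 0)) ≤ Valued.v ϖ ^ (ℓ + 2 * ρ + 2 * t')} =
          {g ∈ R | Valued.v (g + (e 2 - e 1) / (e 2 - e 0)) ≤ Valued.v ϖ ^ (ℓ + 2 * ρ + 2 * t' - k)} :=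
        Set.ext fun g => by rw [Set.mem_setOf_eq, Set.mem_setOf_eq, tokenBall_iff_of_add_eq hϖ0 hEeq]
      rw [hball]
      by_cases hrat : ∃ f : K, σ f = f ∧ Valued.v (f + (e 2 - e 1) / (e 2 - e 0)) ≤ Valued.v ϖ ^ (ℓ + 2 * ρ + 2 * t' - k)
      · rw [if_pos hrat]
        obtain ⟨f₀, hσf₀, hf₀⟩ := hrat
        rw [ncard_glue_representatives_eq hσ hvσ hfix hϖ hd (by omega) (by omega) hRfin hR1 hR2 hR3 hge hσf₀ hf₀,
          show 2 * ρ + 2 * t' - (ℓ + 2 * ρ + 2 * t' - k + 1) / 2 =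
            (ρ + 2 * t' + 1) / 2 - (ℓ + 2 * ρ + 2 * t' - k + 1) / 2 + (ρ + (ρ + 2 * t') / 2) by omega, pow_add]
        push_cast
        ring
      · rw [if_neg hrat, glue_representatives_eq_empty hR1 hrat, Set.ncard_empty, Nat.cast_zero, zero_mul]
  · rw [if_neg hout, if_neg hout]

end Closed

end Summit.HodgeConjecture.HodgeConjecture.Cruxes.H413.F0P3cDyRamLabelledGluedLocusCensus

end
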